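import Summits.CriticalPhenomena.PercolationContinuityZ3.Theorems.PercNearOneGluingNoHeavyQuantLongTailTripleHubAlg
import HarnessLib

/-!
# QUANT lane R8, T-DEC: ALGEBRA OF THE LONG-TAIL QUAD HUB — the capacity inequalities of the width-4 sub-floor hub
# `S(γ₁) ∗ S(γ₂) ∗ S(γ₃) ∗ S(γ₄)` of shape `{lo, lo+K; γ}`, `2lo ≤ K ≤ 4lo`, every gate `γᵢ ≥ lo/K` (census-1 gen 35), the closed forms

builds on p205010 (kernel theorem, internal audit signed; external expert review pending)

Support file (`--supports stmt-CriticalPhenomena-4575`), QUANT lane seat prim-quant-census-1 (gen 35); memo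
`run/shared/lean/prim/quant/prim-quant-census-1/g35/QUADHUB-G35.md`.  Theorems only, standard axioms, no sorries.  Pure real-polynomial
inequalities in K-UNITS: gates `g₁..g₄ ∈ [c, 1]` with `c = lo/K ∈ [1/4, 1/2]`, `d = (T − 8lo)/K` the reduced credit of the gated mean `T`,
`Λ = g₁+g₂+g₃+g₄` (so `d ≤ Λ − 4c`), Poisson-binomial masses `u₀ = Π(1−gᵢ)`, `u₁ = Σᵢ gᵢ Π_{j≠i}(1−gⱼ)`, `u₂ = Σ_{i<j} gᵢgⱼ Π_{k∉{i,j}}(1−gₖ)`,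
`u₃ = Σᵢ (1−gᵢ) Π_{j≠i} gⱼ` of the atoms `4lo, 4lo+K, 4lo+2K, 4lo+3K`.
THE RULE these inequalities serve (memo §1; `…QuantLongTailQuadHub`): one low `4lo` with `0 < d < 1` ships to `4lo+2K` (rate
`max(y, d/2)`); with `1 ≤ d ≤ 2` to `4lo+3K` (rate `max(y, d/3)`); two lows (`d > 2`): `4lo → 4lo+3K` and `4lo+K → 4lo+2K` (rate `max(y, d−2)`);
every route is cost-safe.  This file (all BY HAND):
* `quadHub_capA` — floor part: `(c+g₁)(u₀+u₂) ≤ (1+c)u₂` for the least gate `g₁` (so `x(u₀+u₂) ≤ u₂` whenever `x(lo+K) ≤ lo+Kγ_min`), from the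
  termwise bound `(1−g₁)u₂ ≥ 6g₁²(1−g₂)(1−g₃)(1−g₄)` and `6g₁² ≥ (c+g₁)(1−g₁)` (`c ≥ 1/4`; tight at `g ≡ c = 1/4`);
* `quadHub_capB` — credit part: `d·u₀ ≤ (2−d)u₂` for `0 ≤ d ≤ 1`, `d ≤ Λ − 4c`, from `u₂ ≥ e₂(g)·u₀ ≥ (6c² + 3c(Λ−4c))u₀`;
* `quadHub_coreE` — the TIGHT one: `(Λ+4c)·u₁ ≤ (4−Λ)·u₂` for `Λ ≥ 4c+2` (floor capacity of `4lo+K → 4lo+2K` at the worst credit `d = Λ−4c`; margin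
  `∝ 1/2 − c`): in failure variables `fᵢ = 1−gᵢ` it reduces to `(6−2F)u₁ ≤ F·u₂`, an explicit sum of squares-times-nonnegatives (docstring);
* `quadHub_coreF` — `(Λ−4c−2)·u₁ ≤ (3−Λ+4c)·u₂` for `Λ ≥ 4c+2` (credit capacity of the same route), from the same decomposition.
The remaining two closed forms (`quadHub_coreC/D`, route `4lo → 4lo+3K`) are Handelman certificates (`…QuantLongTailQuadHubCert`); the `(lo, K)`-unit
forms used by the route file are `…QuantLongTailQuadHubAlgK`.
NUMERICS (memo §1, `g35/code/exp1_quad_ineqs.py`, `exp2_quad_rule.py`, exact rationals): 0 failures of the rule on 1.1 M (hub, floor, gate) instances of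
23 shapes; 0 failures of every inequality here on gate grids for `c ∈ {1/4, …, 1/2}`.

HONEST STATUS.  Algebra only; `SiblingStep`, `GluedDominatedMass`, `SDECConvClosed`, `FarTreeRow` OPEN; RATE class (log\*) / honest sentence of
`run/shared/lean/prim/quant/README.md` unchanged.  [this work].  Nothing here is cited as a published result.  The gluing rows served
[cite: KozmaNitzan2024, Conjecture 3 (p. 15)]; product measure [cite: Grimmett1999, §1.3 p. 10].
-/

noncomputable section

namespace Summit.CriticalPhenomena.PercolationContinuityZ3.Theorems
namespace Quant
namespace LawDec

/-- **floor capacity of the route `4lo → 4lo+2K`** (`g₁` the least gate, `1/4 ≤ c ≤ g₁`, all gates `≤ 1`):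
`(c+g₁)·(u₀+u₂) ≤ (1+c)·u₂`, i.e. `x·(u₀+u₂) ≤ u₂` for every floor `x ≤ (lo+Kγ_min)/(lo+K)`.  Termwise `(1−g₁)·gᵢgⱼ(1−gₖ)(1−gₗ) ≥ g₁²(1−gᵢ')…`
via `(1−g₁)gⱼ − g₁(1−gⱼ) = gⱼ − g₁ ≥ 0`, then `6g₁² − (c+g₁)(1−g₁) = (g₁−c)(7g₁+8c−1) + 2c(4c−1) ≥ 0`. [this work] -/
theorem quadHub_capA (g₁ g₂ g₃ g₄ c : ℝ) (hc : 1 / 4 ≤ c) (h1 : c ≤ g₁) (h12 : g₁ ≤ g₂) (h13 : g₁ ≤ g₃) (h14 : g₁ ≤ g₄)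
    (h21 : g₂ ≤ 1) (h31 : g₃ ≤ 1) (h41 : g₄ ≤ 1) :
    (c + g₁) * ((1 - g₁) * (1 - g₂) * (1 - g₃) * (1 - g₄)
        + (g₁ * g₂ * (1 - g₃) * (1 - g₄) + g₁ * g₃ * (1 - g₂) * (1 - g₄) + g₁ * g₄ * (1 - g₂) * (1 - g₃)
          + g₂ * g₃ * (1 - g₁) * (1 - g₄) + g₂ * g₄ * (1 - g₁) * (1 - g₃) + g₃ * g₄ * (1 - g₁) * (1 - g₂)))
      ≤ (1 + c) * (g₁ * g₂ * (1 - g₃) * (1 - g₄) + g₁ * g₃ * (1 - g₂) * (1 - g₄) + g₁ * g₄ * (1 - g₂) * (1 - g₃)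
          + g₂ * g₃ * (1 - g₁) * (1 - g₄) + g₂ * g₄ * (1 - g₁) * (1 - g₃) + g₃ * g₄ * (1 - g₁) * (1 - g₂)) := by
  have hg₁ : 0 ≤ g₁ := by linarith
  have n2 : 0 ≤ 1 - g₂ := by linarith
  have n3 : 0 ≤ 1 - g₃ := by linarith
  have n4 : 0 ≤ 1 - g₄ := by linarith
  -- `(1−g₁)gⱼ − g₁(1−gⱼ) = gⱼ − g₁ ≥ 0`
  have p2 : g₁ * (1 - g₂) ≤ (1 - g₁) * g₂ := by linarith
  have p3 : g₁ * (1 - g₃) ≤ (1 - g₁) * g₃ := by linarith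
  have p4 : g₁ * (1 - g₄) ≤ (1 - g₁) * g₄ := by linarith
  have q2 : 0 ≤ g₁ * (1 - g₂) := mul_nonneg hg₁ n2
  have q3 : 0 ≤ g₁ * (1 - g₃) := mul_nonneg hg₁ n3
  have q4 : 0 ≤ g₁ * (1 - g₄) := mul_nonneg hg₁ n4
  -- the six termwise bounds `(1−g₁)·(term of u₂) ≥ g₁²(1−g₂)(1−g₃)(1−g₄)`
  have t12 := mul_le_mul_of_nonneg_left p2 (mul_nonneg q3 n4)
  have t13 := mul_le_mul_of_nonneg_left p3 (mul_nonneg q2 n4)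
  have t14 := mul_le_mul_of_nonneg_left p4 (mul_nonneg q2 n3)
  have t23 := mul_le_mul_of_nonneg_right (mul_le_mul p2 p3 q3 (le_trans q2 p2)) n4
  have t24 := mul_le_mul_of_nonneg_right (mul_le_mul p2 p4 q4 (le_trans q2 p2)) n3
  have t34 := mul_le_mul_of_nonneg_right (mul_le_mul p3 p4 q4 (le_trans q3 p3)) n2
  -- `6g₁² − (c+g₁)(1−g₁) = (g₁−c)(7g₁+8c−1) + 2c(4c−1) ≥ 0`
  have poly : (c + g₁) * (1 - g₁) ≤ 6 * (g₁ * g₁) := by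
    linarith [mul_nonneg (sub_nonneg.2 h1) (show (0:ℝ) ≤ 7 * g₁ + 8 * c - 1 by linarith),
      mul_nonneg (show (0:ℝ) ≤ 2 * c by linarith) (show (0:ℝ) ≤ 4 * c - 1 by linarith)]
  have h6 := mul_le_mul_of_nonneg_right poly (mul_nonneg (mul_nonneg n2 n3) n4)
  linarith [h6, t12, t13, t14, t23, t24, t34]

/-- **credit capacity of the route `4lo → 4lo+2K`** (gates in `[c, 1]`, `1/4 ≤ c`, `0 ≤ d ≤ 1`, `d ≤ Λ − 4c`): `d·u₀ ≤ (2 − d)·u₂`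
(i.e. `(d/2)(u₀+u₂) ≤ u₂`).  From `u₂ ≥ e₂(g)·u₀` (termwise, `(1−gᵢ)(1−gⱼ) ≤ 1`), `e₂(g) ≥ 6c² + 3c(Λ−4c) ≥ 6c² + 3cd`, and
`(2−d)(6c²+3cd) − d = 6t²(2−d) + 3td(1−d) + (3/4)(1−d)(1+d) + 6t + d/8 ≥ 0`, `t = c − 1/4`. [this work] -/
theorem quadHub_capB (g₁ g₂ g₃ g₄ c d : ℝ) (hc : 1 / 4 ≤ c) (h1 : c ≤ g₁) (h2 : c ≤ g₂) (h3 : c ≤ g₃) (h4 : c ≤ g₄)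
    (h11 : g₁ ≤ 1) (h21 : g₂ ≤ 1) (h31 : g₃ ≤ 1) (h41 : g₄ ≤ 1) (hd0 : 0 ≤ d) (hd1 : d ≤ 1) (hdS : d ≤ g₁ + g₂ + g₃ + g₄ - 4 * c) :
    d * ((1 - g₁) * (1 - g₂) * (1 - g₃) * (1 - g₄))
      ≤ (2 - d) * (g₁ * g₂ * (1 - g₃) * (1 - g₄) + g₁ * g₃ * (1 - g₂) * (1 - g₄) + g₁ * g₄ * (1 - g₂) * (1 - g₃)
          + g₂ * g₃ * (1 - g₁) * (1 - g₄) + g₂ * g₄ * (1 - g₁) * (1 - g₃) + g₃ * g₄ * (1 - g₁) * (1 - g₂)) := by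
  have c0 : 0 ≤ c := by linarith
  have n1 : 0 ≤ 1 - g₁ := by linarith
  have n2 : 0 ≤ 1 - g₂ := by linarith
  have n3 : 0 ≤ 1 - g₃ := by linarith
  have n4 : 0 ≤ 1 - g₄ := by linarith
  have hg₁ : 0 ≤ g₁ := by linarith
  have hg₂ : 0 ≤ g₂ := by linarith
  have hg₃ : 0 ≤ g₃ := by linarith
  have hg₄ : 0 ≤ g₄ := by linarith
  have hu0n : 0 ≤ (1 - g₁) * (1 - g₂) * (1 - g₃) * (1 - g₄) := mul_nonneg (mul_nonneg (mul_nonneg n1 n2) n3) n4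
  -- `(1−gᵢ)(1−gⱼ) ≤ 1`
  have l12 : (1 - g₁) * (1 - g₂) ≤ 1 := by nlinarith [mul_nonneg hg₁ hg₂]
  have l13 : (1 - g₁) * (1 - g₃) ≤ 1 := by nlinarith [mul_nonneg hg₁ hg₃]
  have l14 : (1 - g₁) * (1 - g₄) ≤ 1 := by nlinarith [mul_nonneg hg₁ hg₄]
  have l23 : (1 - g₂) * (1 - g₃) ≤ 1 := by nlinarith [mul_nonneg hg₂ hg₃]
  have l24 : (1 - g₂) * (1 - g₄) ≤ 1 := by nlinarith [mul_nonneg hg₂ hg₄]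
  have l34 : (1 - g₃) * (1 - g₄) ≤ 1 := by nlinarith [mul_nonneg hg₃ hg₄]
  -- so each term of `u₂` dominates `gᵢgⱼ·u₀`
  have s12 := mul_le_mul_of_nonneg_left l12 (mul_nonneg (mul_nonneg (mul_nonneg hg₁ hg₂) n3) n4)
  have s13 := mul_le_mul_of_nonneg_left l13 (mul_nonneg (mul_nonneg (mul_nonneg hg₁ hg₃) n2) n4)
  have s14 := mul_le_mul_of_nonneg_left l14 (mul_nonneg (mul_nonneg (mul_nonneg hg₁ hg₄) n2) n3)
  have s23 := mul_le_mul_of_nonneg_left l23 (mul_nonneg (mul_nonneg (mul_nonneg hg₂ hg₃) n1) n4)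
  have s24 := mul_le_mul_of_nonneg_left l24 (mul_nonneg (mul_nonneg (mul_nonneg hg₂ hg₄) n1) n3)
  have s34 := mul_le_mul_of_nonneg_left l34 (mul_nonneg (mul_nonneg (mul_nonneg hg₃ hg₄) n1) n2)
  -- `e₂(g) ≥ 6c² + 3c·d`
  have he2g : 6 * c ^ 2 + 3 * c * d ≤ g₁ * g₂ + g₁ * g₃ + g₁ * g₄ + g₂ * g₃ + g₂ * g₄ + g₃ * g₄ := by
    nlinarith [mul_nonneg (sub_nonneg.2 h1) (sub_nonneg.2 h2), mul_nonneg (sub_nonneg.2 h1) (sub_nonneg.2 h3),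
      mul_nonneg (sub_nonneg.2 h1) (sub_nonneg.2 h4), mul_nonneg (sub_nonneg.2 h2) (sub_nonneg.2 h3),
      mul_nonneg (sub_nonneg.2 h2) (sub_nonneg.2 h4), mul_nonneg (sub_nonneg.2 h3) (sub_nonneg.2 h4),
      mul_nonneg c0 (show 0 ≤ g₁ + g₂ + g₃ + g₄ - 4 * c - d by linarith)]
  -- `(2−d)(6c²+3cd) ≥ d`
  have ht : 0 ≤ c - 1 / 4 := by linarith
  have h2d : 0 ≤ 2 - d := by linarith
  have h1d : 0 ≤ 1 - d := by linarith
  have hsc : d ≤ (2 - d) * (6 * c ^ 2 + 3 * c * d) := by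
    have k1 : 0 ≤ (c - 1 / 4) * (c - 1 / 4) * (2 - d) := mul_nonneg (mul_nonneg ht ht) h2d
    have k2 : 0 ≤ (c - 1 / 4) * d * (1 - d) := mul_nonneg (mul_nonneg ht hd0) h1d
    have k3 : 0 ≤ (1 - d) * (1 + d) := mul_nonneg h1d (by linarith)
    linarith [k1, k2, k3]
  have a1 := mul_le_mul_of_nonneg_right hsc hu0n
  have a2 := mul_le_mul_of_nonneg_left (mul_le_mul_of_nonneg_right he2g hu0n) h2d
  have b12 := mul_le_mul_of_nonneg_left s12 h2d
  have b13 := mul_le_mul_of_nonneg_left s13 h2d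
  have b14 := mul_le_mul_of_nonneg_left s14 h2d
  have b23 := mul_le_mul_of_nonneg_left s23 h2d
  have b24 := mul_le_mul_of_nonneg_left s24 h2d
  have b34 := mul_le_mul_of_nonneg_left s34 h2d
  linarith [a1, a2, b12, b13, b14, b23, b24, b34]


/-- **core (E′)**: `(Λ+4c)·u₁ ≤ (4−Λ)·u₂` for gates in `[c,1]`, `c ≥ 1/4`, `Λ ≥ 4c+2` (floor capacity of `4lo+K → 4lo+2K` at the worst credit
`d = Λ−4c`; the tight inequality of the quad hub, margin `∝ 1/2 − c`).  BY HAND, in the failure variables `fᵢ = 1−gᵢ` (`F = Σfᵢ ≤ 2−4c ≤ 1`):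
`Λ+4c ≤ 6−2F` reduces it to `(6−2F)·u₁ ≤ F·u₂`, and
`F·u₂ − (6−2F)·u₁ = ½(1−F)Σ_{triples}[a(b−c)²+b(c−a)²+c(a−b)²] + 2(1−F)e₄ + Σ_{i<j} fᵢfⱼ(fᵢ−fⱼ)² + Σᵢ fᵢ² Σ_{j<k≠i}(fⱼ−fₖ)² + 6e₄`
(an explicit sum of nonnegative terms; checked by `linarith`). [this work] -/
theorem quadHub_coreE (g₁ g₂ g₃ g₄ c : ℝ) (hc : 1 / 4 ≤ c) (h1 : c ≤ g₁) (h2 : c ≤ g₂) (h3 : c ≤ g₃) (h4 : c ≤ g₄)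
    (h11 : g₁ ≤ 1) (h21 : g₂ ≤ 1) (h31 : g₃ ≤ 1) (h41 : g₄ ≤ 1) (hS : 4 * c + 2 ≤ g₁ + g₂ + g₃ + g₄) :
    (g₁ + g₂ + g₃ + g₄ + 4 * c) * (g₁ * (1 - g₂) * (1 - g₃) * (1 - g₄) + g₂ * (1 - g₁) * (1 - g₃) * (1 - g₄)
        + g₃ * (1 - g₁) * (1 - g₂) * (1 - g₄) + g₄ * (1 - g₁) * (1 - g₂) * (1 - g₃))
      ≤ (4 - (g₁ + g₂ + g₃ + g₄)) * (g₁ * g₂ * (1 - g₃) * (1 - g₄) + g₁ * g₃ * (1 - g₂) * (1 - g₄) + g₁ * g₄ * (1 - g₂) * (1 - g₃)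
          + g₂ * g₃ * (1 - g₁) * (1 - g₄) + g₂ * g₄ * (1 - g₁) * (1 - g₃) + g₃ * g₄ * (1 - g₁) * (1 - g₂)) := by
  have e1 : 0 ≤ 1 - g₁ := sub_nonneg.2 h11
  have e2 : 0 ≤ 1 - g₂ := sub_nonneg.2 h21
  have e3 : 0 ≤ 1 - g₃ := sub_nonneg.2 h31
  have e4 : 0 ≤ 1 - g₄ := sub_nonneg.2 h41
  have p1 : 0 ≤ g₁ := by linarith
  have p2 : 0 ≤ g₂ := by linarith
  have p3 : 0 ≤ g₃ := by linarith
  have p4 : 0 ≤ g₄ := by linarith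
  have hF : 0 ≤ g₁ + g₂ + g₃ + g₄ - 3 := by linarith
  have hS0 : 0 ≤ g₁ + g₂ + g₃ + g₄ - 4 * c - 2 := by linarith
  have u1nn : 0 ≤ g₁ * (1 - g₂) * (1 - g₃) * (1 - g₄) + g₂ * (1 - g₁) * (1 - g₃) * (1 - g₄)
      + g₃ * (1 - g₁) * (1 - g₂) * (1 - g₄) + g₄ * (1 - g₁) * (1 - g₂) * (1 - g₃) := by positivity
  -- the SOS pieces (failure variables `1 − gᵢ`; `(1−gᵢ) − (1−gⱼ) = gⱼ − gᵢ`)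
  have t123 : 0 ≤ (g₁ + g₂ + g₃ + g₄ - 3) * ((1 - g₁) * (g₂ - g₃) ^ 2 + (1 - g₂) * (g₃ - g₁) ^ 2 + (1 - g₃) * (g₁ - g₂) ^ 2) :=
    mul_nonneg hF (by positivity)
  have t124 : 0 ≤ (g₁ + g₂ + g₃ + g₄ - 3) * ((1 - g₁) * (g₂ - g₄) ^ 2 + (1 - g₂) * (g₄ - g₁) ^ 2 + (1 - g₄) * (g₁ - g₂) ^ 2) :=
    mul_nonneg hF (by positivity)
  have t134 : 0 ≤ (g₁ + g₂ + g₃ + g₄ - 3) * ((1 - g₁) * (g₃ - g₄) ^ 2 + (1 - g₃) * (g₄ - g₁) ^ 2 + (1 - g₄) * (g₁ - g₃) ^ 2) :=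
    mul_nonneg hF (by positivity)
  have t234 : 0 ≤ (g₁ + g₂ + g₃ + g₄ - 3) * ((1 - g₂) * (g₃ - g₄) ^ 2 + (1 - g₃) * (g₄ - g₂) ^ 2 + (1 - g₄) * (g₂ - g₃) ^ 2) :=
    mul_nonneg hF (by positivity)
  have q4 : 0 ≤ (g₁ + g₂ + g₃ + g₄ - 3) * ((1 - g₁) * (1 - g₂) * (1 - g₃) * (1 - g₄)) := mul_nonneg hF (by positivity)
  have e4nn : 0 ≤ (1 - g₁) * (1 - g₂) * (1 - g₃) * (1 - g₄) := by positivity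
  have pr12 : 0 ≤ (1 - g₁) * (1 - g₂) * (g₁ - g₂) ^ 2 := by positivity
  have pr13 : 0 ≤ (1 - g₁) * (1 - g₃) * (g₁ - g₃) ^ 2 := by positivity
  have pr14 : 0 ≤ (1 - g₁) * (1 - g₄) * (g₁ - g₄) ^ 2 := by positivity
  have pr23 : 0 ≤ (1 - g₂) * (1 - g₃) * (g₂ - g₃) ^ 2 := by positivity
  have pr24 : 0 ≤ (1 - g₂) * (1 - g₄) * (g₂ - g₄) ^ 2 := by positivity
  have pr34 : 0 ≤ (1 - g₃) * (1 - g₄) * (g₃ - g₄) ^ 2 := by positivity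
  have s1a : 0 ≤ (1 - g₁) ^ 2 * (g₂ - g₃) ^ 2 := by positivity
  have s1b : 0 ≤ (1 - g₁) ^ 2 * (g₂ - g₄) ^ 2 := by positivity
  have s1c : 0 ≤ (1 - g₁) ^ 2 * (g₃ - g₄) ^ 2 := by positivity
  have s2a : 0 ≤ (1 - g₂) ^ 2 * (g₁ - g₃) ^ 2 := by positivity
  have s2b : 0 ≤ (1 - g₂) ^ 2 * (g₁ - g₄) ^ 2 := by positivity
  have s2c : 0 ≤ (1 - g₂) ^ 2 * (g₃ - g₄) ^ 2 := by positivity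
  have s3a : 0 ≤ (1 - g₃) ^ 2 * (g₁ - g₂) ^ 2 := by positivity
  have s3b : 0 ≤ (1 - g₃) ^ 2 * (g₁ - g₄) ^ 2 := by positivity
  have s3c : 0 ≤ (1 - g₃) ^ 2 * (g₂ - g₄) ^ 2 := by positivity
  have s4a : 0 ≤ (1 - g₄) ^ 2 * (g₁ - g₂) ^ 2 := by positivity
  have s4b : 0 ≤ (1 - g₄) ^ 2 * (g₁ - g₃) ^ 2 := by positivity
  have s4c : 0 ≤ (1 - g₄) ^ 2 * (g₂ - g₃) ^ 2 := by positivity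
  linarith [mul_nonneg hS0 u1nn, t123, t124, t134, t234, q4, e4nn, pr12, pr13, pr14, pr23, pr24, pr34,
    s1a, s1b, s1c, s2a, s2b, s2c, s3a, s3b, s3c, s4a, s4b, s4c]

/-- **core (F′)**: `(Λ−4c−2)·u₁ ≤ (3−Λ+4c)·u₂` for gates in `[c,1]`, `c ≥ 1/4`, `Λ ≥ 4c+2` (credit capacity of `4lo+K → 4lo+2K` at the worst
credit `d = Λ−4c`).  BY HAND: with `F = 4 − Λ`, `(3−Λ+4c)u₂ − (Λ−4c−2)u₁ = (4c−1)(u₁+u₂) + (5−F)u₁ + [F·u₂ − (6−2F)u₁]`, the bracket being the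
explicit sum of nonnegative terms of `quadHub_coreE`. [this work] -/
theorem quadHub_coreF (g₁ g₂ g₃ g₄ c : ℝ) (hc : 1 / 4 ≤ c) (h1 : c ≤ g₁) (h2 : c ≤ g₂) (h3 : c ≤ g₃) (h4 : c ≤ g₄)
    (h11 : g₁ ≤ 1) (h21 : g₂ ≤ 1) (h31 : g₃ ≤ 1) (h41 : g₄ ≤ 1) (hS : 4 * c + 2 ≤ g₁ + g₂ + g₃ + g₄) :
    (g₁ + g₂ + g₃ + g₄ - 4 * c - 2) * (g₁ * (1 - g₂) * (1 - g₃) * (1 - g₄) + g₂ * (1 - g₁) * (1 - g₃) * (1 - g₄)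
        + g₃ * (1 - g₁) * (1 - g₂) * (1 - g₄) + g₄ * (1 - g₁) * (1 - g₂) * (1 - g₃))
      ≤ (3 - (g₁ + g₂ + g₃ + g₄) + 4 * c) * (g₁ * g₂ * (1 - g₃) * (1 - g₄) + g₁ * g₃ * (1 - g₂) * (1 - g₄) + g₁ * g₄ * (1 - g₂) * (1 - g₃)
          + g₂ * g₃ * (1 - g₁) * (1 - g₄) + g₂ * g₄ * (1 - g₁) * (1 - g₃) + g₃ * g₄ * (1 - g₁) * (1 - g₂)) := by
  have e1 : 0 ≤ 1 - g₁ := sub_nonneg.2 h11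
  have e2 : 0 ≤ 1 - g₂ := sub_nonneg.2 h21
  have e3 : 0 ≤ 1 - g₃ := sub_nonneg.2 h31
  have e4 : 0 ≤ 1 - g₄ := sub_nonneg.2 h41
  have p1 : 0 ≤ g₁ := by linarith
  have p2 : 0 ≤ g₂ := by linarith
  have p3 : 0 ≤ g₃ := by linarith
  have p4 : 0 ≤ g₄ := by linarith
  have hF : 0 ≤ g₁ + g₂ + g₃ + g₄ - 3 := by linarith
  have u1nn : 0 ≤ g₁ * (1 - g₂) * (1 - g₃) * (1 - g₄) + g₂ * (1 - g₁) * (1 - g₃) * (1 - g₄)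
      + g₃ * (1 - g₁) * (1 - g₂) * (1 - g₄) + g₄ * (1 - g₁) * (1 - g₂) * (1 - g₃) := by positivity
  have u2nn : 0 ≤ g₁ * g₂ * (1 - g₃) * (1 - g₄) + g₁ * g₃ * (1 - g₂) * (1 - g₄) + g₁ * g₄ * (1 - g₂) * (1 - g₃)
          + g₂ * g₃ * (1 - g₁) * (1 - g₄) + g₂ * g₄ * (1 - g₁) * (1 - g₃) + g₃ * g₄ * (1 - g₁) * (1 - g₂) := by positivity
  have hc41 : 0 ≤ 4 * c - 1 := by linarith
  have h5F : 0 ≤ 1 + (g₁ + g₂ + g₃ + g₄) := by linarith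
  -- the SOS pieces (failure variables `1 − gᵢ`; `(1−gᵢ) − (1−gⱼ) = gⱼ − gᵢ`)
  have t123 : 0 ≤ (g₁ + g₂ + g₃ + g₄ - 3) * ((1 - g₁) * (g₂ - g₃) ^ 2 + (1 - g₂) * (g₃ - g₁) ^ 2 + (1 - g₃) * (g₁ - g₂) ^ 2) :=
    mul_nonneg hF (by positivity)
  have t124 : 0 ≤ (g₁ + g₂ + g₃ + g₄ - 3) * ((1 - g₁) * (g₂ - g₄) ^ 2 + (1 - g₂) * (g₄ - g₁) ^ 2 + (1 - g₄) * (g₁ - g₂) ^ 2) :=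
    mul_nonneg hF (by positivity)
  have t134 : 0 ≤ (g₁ + g₂ + g₃ + g₄ - 3) * ((1 - g₁) * (g₃ - g₄) ^ 2 + (1 - g₃) * (g₄ - g₁) ^ 2 + (1 - g₄) * (g₁ - g₃) ^ 2) :=
    mul_nonneg hF (by positivity)
  have t234 : 0 ≤ (g₁ + g₂ + g₃ + g₄ - 3) * ((1 - g₂) * (g₃ - g₄) ^ 2 + (1 - g₃) * (g₄ - g₂) ^ 2 + (1 - g₄) * (g₂ - g₃) ^ 2) :=
    mul_nonneg hF (by positivity)
  have q4 : 0 ≤ (g₁ + g₂ + g₃ + g₄ - 3) * ((1 - g₁) * (1 - g₂) * (1 - g₃) * (1 - g₄)) := mul_nonneg hF (by positivity)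
  have e4nn : 0 ≤ (1 - g₁) * (1 - g₂) * (1 - g₃) * (1 - g₄) := by positivity
  have pr12 : 0 ≤ (1 - g₁) * (1 - g₂) * (g₁ - g₂) ^ 2 := by positivity
  have pr13 : 0 ≤ (1 - g₁) * (1 - g₃) * (g₁ - g₃) ^ 2 := by positivity
  have pr14 : 0 ≤ (1 - g₁) * (1 - g₄) * (g₁ - g₄) ^ 2 := by positivity
  have pr23 : 0 ≤ (1 - g₂) * (1 - g₃) * (g₂ - g₃) ^ 2 := by positivity
  have pr24 : 0 ≤ (1 - g₂) * (1 - g₄) * (g₂ - g₄) ^ 2 := by positivity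
  have pr34 : 0 ≤ (1 - g₃) * (1 - g₄) * (g₃ - g₄) ^ 2 := by positivity
  have s1a : 0 ≤ (1 - g₁) ^ 2 * (g₂ - g₃) ^ 2 := by positivity
  have s1b : 0 ≤ (1 - g₁) ^ 2 * (g₂ - g₄) ^ 2 := by positivity
  have s1c : 0 ≤ (1 - g₁) ^ 2 * (g₃ - g₄) ^ 2 := by positivity
  have s2a : 0 ≤ (1 - g₂) ^ 2 * (g₁ - g₃) ^ 2 := by positivity
  have s2b : 0 ≤ (1 - g₂) ^ 2 * (g₁ - g₄) ^ 2 := by positivity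
  have s2c : 0 ≤ (1 - g₂) ^ 2 * (g₃ - g₄) ^ 2 := by positivity
  have s3a : 0 ≤ (1 - g₃) ^ 2 * (g₁ - g₂) ^ 2 := by positivity
  have s3b : 0 ≤ (1 - g₃) ^ 2 * (g₁ - g₄) ^ 2 := by positivity
  have s3c : 0 ≤ (1 - g₃) ^ 2 * (g₂ - g₄) ^ 2 := by positivity
  have s4a : 0 ≤ (1 - g₄) ^ 2 * (g₁ - g₂) ^ 2 := by positivity
  have s4b : 0 ≤ (1 - g₄) ^ 2 * (g₁ - g₃) ^ 2 := by positivity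
  have s4c : 0 ≤ (1 - g₄) ^ 2 * (g₂ - g₃) ^ 2 := by positivity
  linarith [mul_nonneg hc41 (add_nonneg u1nn u2nn), mul_nonneg h5F u1nn, t123, t124, t134, t234, q4, e4nn, pr12, pr13, pr14, pr23, pr24, pr34,
    s1a, s1b, s1c, s2a, s2b, s2c, s3a, s3b, s3c, s4a, s4b, s4c]

end LawDec
end Quant
end Summit.CriticalPhenomena.PercolationContinuityZ3.Theorems
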